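import Summits.AtomisticToContinuum.Crystallization.Theorems.FrustratedLawDichotomyStrainedPatchHomEntrySemanticQuotB

/-!
# Strained patch, (H) hcp root over the D₃ₕ point-group quotient «HomEntrySemanticQuot» (lens-5 NODE 88) — part 3 of 3 (sequel of `…FrustratedLawDichotomyStrainedPatchHomEntrySemanticQuotB`)

Split for the 400-line cap by the landing lane (hand-2 g39); the module docstring of part 1 (`…FrustratedLawDichotomyStrainedPatchHomEntrySemanticQuotA`) describes the whole node.  Same namespace; all FQNs unchanged.
0 sorry; standard axioms.
-/

noncomputable section

namespace Summit.AtomisticToContinuum.Crystallization.Theorems.FrustratedLawDichotomyStrainedPatchHomEntrySemanticQuot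

open scoped BigOperators RealInnerProductSpace
open Literature.Analysis.ValidatedNumerics.Numerics
open Summit.AtomisticToContinuum.Crystallization.Theorems.ChargedEnergyGapNegative (E3)
open Summit.AtomisticToContinuum.Crystallization.Theorems.FrustratedLawDichotomySchurCut (effPot w₄₅ ω₄)
open Summit.AtomisticToContinuum.Crystallization.Theorems.FrustratedLawDichotomyAveragingRuleTightFree (TightNearCap BadNearCap)
open Summit.AtomisticToContinuum.Crystallization.Theorems.FrustratedLawDichotomyExemptAbsorption (ExemptNear)
open Summit.AtomisticToContinuum.Crystallization.Theorems.FrustratedLawDichotomyStrainedPatchHomSplit (ExRec latPt hexFrame hcpShift HomFloor)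
open Summit.AtomisticToContinuum.Crystallization.Theorems.FrustratedLawDichotomyStrainedPatchHomCover (shuffle_mem_rootCube)
open Summit.AtomisticToContinuum.Crystallization.Theorems.FrustratedLawDichotomyStrainedPatchHomPrunedPolar (homFloor_of_prunedBoxSums_selfAdjoint)
open Summit.AtomisticToContinuum.Crystallization.Theorems.FrustratedLawDichotomyStrainedPatchHomCertTree (CertTree treeOK)
open Summit.AtomisticToContinuum.Crystallization.Theorems.FrustratedLawDichotomyStrainedPatchHomEntryGram (rootC rootW rootW_div mem_root_of_near_one)
open Summit.AtomisticToContinuum.Crystallization.Theorems.FrustratedLawDichotomyStrainedPatchHomEntryGramHcp (rootCH rootWH)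
open Summit.AtomisticToContinuum.Crystallization.Theorems.FrustratedLawDichotomyStrainedPatchHomEntrySignKit (flipIso flipIso_apply flip_entry conjIso_selfAdjoint conjIso_pos conjIso_norm_sub_one_le)
open Summit.AtomisticToContinuum.Crystallization.Theorems.FrustratedLawDichotomyStrainedPatchHomEntryFlipHcp (HcpDich hcpDich_of_flip)
open Summit.AtomisticToContinuum.Crystallization.Theorems.FrustratedLawDichotomyStrainedPatchHomEntryMirrorHcpKit (mirIso mirIso_apply)
open Summit.AtomisticToContinuum.Crystallization.Theorems.FrustratedLawDichotomyStrainedPatchHomEntryMirrorHcp (hcpDich_of_mir)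
open Summit.AtomisticToContinuum.Crystallization.Theorems.FrustratedLawDichotomyStrainedPatchHomEntryLeafHT (hcpCoord HcpLeafGoal inHcpBox_iff hcpLeafGoal_mono semOKH semOKH_forall semOKH_of_sound abs_sub_div_le_of_contained abs_sub_div_le_or_of_cut entryLeafOK6RBKP4 fccHalf_of_entryTree6RBKP4 hcpHalf_of_semOKH)

/-! ## §6. The quarter root box and the root consumers -/

/-- Root CENTRE of the quarter box: `rootCH` with `u₀₁`-centre `SC/8` and `u₁₂`-centre `−SC/8`. -/
def rootCHQ : (Fin 3 × Fin 3) ⊕ Fin 3 → ℤ :=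
  Function.update (Function.update rootCH (Sum.inl (0, 1)) 35184372088832) (Sum.inl (1, 2)) (-35184372088832)

/-- Root HALF-WIDTH of the quarter box: `rootWH` (`SC/4`) with `SC/8` on the two wall entries. -/
def rootWHQ : (Fin 3 × Fin 3) ⊕ Fin 3 → ℤ :=
  Function.update (Function.update rootWH (Sum.inl (0, 1)) 35184372088832) (Sum.inl (1, 2)) 35184372088832

/-- Values of the quarter root box on the two wall entries and elsewhere. [formal bookkeeping] -/
theorem rootCHQ_wall12 : rootCHQ (Sum.inl (1, 2)) = -35184372088832 := by simp [rootCHQ]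

/-- The quarter root box: half-width `2⁴⁵` at the wall entry `(1,2)` (lane docstring, hand-2 g39). -/
theorem rootWHQ_wall12 : rootWHQ (Sum.inl (1, 2)) = 35184372088832 := by simp [rootWHQ]

/-- The quarter root box: centre `2⁴⁵` at the wall entry `(0,1)` (lane docstring, hand-2 g39). -/
theorem rootCHQ_wall01 : rootCHQ (Sum.inl (0, 1)) = 35184372088832 := by simp [rootCHQ]

/-- The quarter root box: half-width `2⁴⁵` at the wall entry `(0,1)` (lane docstring, hand-2 g39). -/
theorem rootWHQ_wall01 : rootWHQ (Sum.inl (0, 1)) = 35184372088832 := by simp [rootWHQ]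

/-- Off the two wall entries the quarter root box has the root centre (lane docstring, hand-2 g39). -/
theorem rootCHQ_of_ne {k : (Fin 3 × Fin 3) ⊕ Fin 3} (h1 : k ≠ Sum.inl (1, 2)) (h0 : k ≠ Sum.inl (0, 1)) : rootCHQ k = rootCH k := by
  simp [rootCHQ, h1, h0]

/-- Off the two wall entries the quarter root box has the root half-width (lane docstring, hand-2 g39). -/
theorem rootWHQ_of_ne {k : (Fin 3 × Fin 3) ⊕ Fin 3} (h1 : k ≠ Sum.inl (1, 2)) (h0 : k ≠ Sum.inl (0, 1)) : rootWHQ k = rootWH k := by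
  simp [rootWHQ, h1, h0]

/-- `SC/8`, `−SC/8`, `SC/4`, `0` as real numbers. [formal bookkeeping] -/
theorem eighth_div : ((35184372088832 : ℤ) : ℝ) / SC = 1 / 8 := by norm_num [SC]

/-- `−2⁴⁵/SC = −1/8` (lane docstring, hand-2 g39). -/
theorem neg_eighth_div : ((-35184372088832 : ℤ) : ℝ) / SC = -(1 / 8) := by norm_num [SC]

/-- Off-diagonal root centre entries are `0` after division by `SC` (lane docstring, hand-2 g39). -/
theorem rootC_offdiag_div {a b : Fin 3} (h : a ≠ b) : ((rootC (a, b) : ℤ) : ℝ) / SC = 0 := by simp [rootC, h]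

/-- Root half-widths are `1/4` after division by `SC` (lane docstring, hand-2 g39). -/
theorem rootW_apply_div (ab : Fin 3 × Fin 3) : ((rootW ab : ℤ) : ℝ) / SC = 1 / 4 := rootW_div

/-- ★ Every admissible pair of the fundamental domain lies in the quarter root box. [formal bookkeeping] -/
theorem mem_rootQ {U : E3 →L[ℝ] E3} {ξ : E3} (hU : ‖U - 1‖ ≤ 1 / 4) (hξ : ‖ξ‖ ≤ 1 / 4) (h01 : 0 ≤ (U (EuclideanSpace.single 1 (1 : ℝ))) 0)
    (h12 : (U (EuclideanSpace.single 2 (1 : ℝ))) 1 ≤ 0) : ∀ k, |hcpCoord U ξ k - (rootCHQ k : ℝ) / SC| ≤ (rootWHQ k : ℝ) / SC := by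
  have hroot : ∀ ab : Fin 3 × Fin 3, |(U (EuclideanSpace.single ab.2 (1 : ℝ))) ab.1 - (rootC ab : ℝ) / SC| ≤ (rootW ab : ℝ) / SC :=
    fun ab => mem_root_of_near_one hU ab
  intro k
  by_cases hk12 : k = Sum.inl (1, 2)
  · subst hk12
    rw [rootCHQ_wall12, rootWHQ_wall12, neg_eighth_div, eighth_div]
    have h := hroot (1, 2)
    rw [rootC_offdiag_div (by decide), rootW_apply_div, sub_zero] at h
    simp only [hcpCoord, Sum.elim_inl] at h ⊢
    rw [abs_le] at h ⊢
    constructor <;> linarith [h.1, h.2, h12]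
  by_cases hk01 : k = Sum.inl (0, 1)
  · subst hk01
    rw [rootCHQ_wall01, rootWHQ_wall01, eighth_div]
    have h := hroot (0, 1)
    rw [rootC_offdiag_div (by decide), rootW_apply_div, sub_zero] at h
    simp only [hcpCoord, Sum.elim_inl] at h ⊢
    rw [abs_le] at h ⊢
    constructor <;> linarith [h.1, h.2, h01]
  rw [rootCHQ_of_ne hk12 hk01, rootWHQ_of_ne hk12 hk01]
  rcases k with ab | i
  · simp only [hcpCoord, Sum.elim_inl, rootCH, rootWH]
    exact hroot ab
  · simp only [hcpCoord, Sum.elim_inr, rootCH, rootWH]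
    have e0 : ((0 : ℤ) : ℝ) / SC = 0 := by simp
    rw [e0, rootW_div]
    exact shuffle_mem_rootCube hξ i

/-- ★★★ **THE hcp HALF FROM THE ONE SEMANTIC FACT ON THE QUARTER ROOT BOX** `semOKHQ μ rootCHQ rootWHQ = true` (every `m` with
`2 (m + e_W) SC ≤ μ`) — the `hhcp` hypothesis of `…HomPrunedPolar.homFloor_of_prunedBoxSums_selfAdjoint` VERBATIM. [folklore chaining] -/
theorem hcpHalf_of_semOKHQ {m : ℝ} {μ : ℤ} (hμ : 2 * (m + (-(7175 / 10000) + 3 / 400)) * SC ≤ μ) (h : semOKHQ μ rootCHQ rootWHQ = true) :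
    ∀ (U : E3 →L[ℝ] E3) (ξ : E3), (∀ v w : E3, inner ℝ (U v) w = inner ℝ v (U w)) → (∀ w : E3, 0 ≤ inner ℝ w (U w)) →
      ‖U - 1‖ ≤ 1 / 4 → ‖ξ‖ ≤ 1 / 4 → HcpDich m U ξ :=
  hcpHalf_of_quotU fun U ξ hsa hpos hU hξ h01 h12 hb hab =>
    hcpDich_of_hcpLeafGoal hμ (semOKHQ_forall h U ξ hsa hpos hU hξ (mem_rootQ hU hξ h01 h12) hb hab)

/-- ★★★ **`(H) HomFloor m` FROM THE fcc ∃-TREE OVER THE LEVEL-CLOSED VERDICT v4 AND THE hcp SEMANTIC FACT ON THE QUARTER ROOT BOX** at any level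
`μ` with `2 (m + e_W) SC ≤ μ` — the shape consumed by the consumers of record (`…F6pT26…`, `…F6T26…`). [folklore] -/
theorem homFloor_of_entryTree6RBKP4_semOKHQ {m : ℝ} {μ : ℤ} (hμ : 2 * (m + (-(7175 / 10000) + 3 / 400)) * SC ≤ μ)
    (hF : ∃ t : CertTree (Fin 3 × Fin 3), treeOK (entryLeafOK6RBKP4 μ) t rootC rootW = true) (hH : semOKHQ μ rootCHQ rootWHQ = true) :
    HomFloor m := by
  obtain ⟨tF, htF⟩ := hF
  exact homFloor_of_prunedBoxSums_selfAdjoint (fccHalf_of_entryTree6RBKP4 hμ htF) (hcpHalf_of_semOKHQ hμ hH)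

/-- ★★★ The same with the hcp side given as ANY `treeOK` TREE on the quarter root box over a verdict whose accepted boxes are `semOKHQ` facts
(e.g. `quotLeaf v` for a sign-free sound `v`, or a table of converted landed cells). [folklore] -/
theorem homFloor_of_entryTree6RBKP4_treeQ {m : ℝ} {μ : ℤ} (hμ : 2 * (m + (-(7175 / 10000) + 3 / 400)) * SC ≤ μ)
    (hF : ∃ t : CertTree (Fin 3 × Fin 3), treeOK (entryLeafOK6RBKP4 μ) t rootC rootW = true)
    (verdict : ((Fin 3 × Fin 3) ⊕ Fin 3 → ℤ) → ((Fin 3 × Fin 3) ⊕ Fin 3 → ℤ) → Bool) (hv : ∀ c w, verdict c w = true → semOKHQ μ c w = true)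
    (hH : ∃ t : CertTree ((Fin 3 × Fin 3) ⊕ Fin 3), treeOK verdict t rootCHQ rootWHQ = true) : HomFloor m := by
  obtain ⟨t, ht⟩ := hH
  exact homFloor_of_entryTree6RBKP4_semOKHQ hμ hF (semOKHQ_of_treeOK verdict hv t _ _ ht)

/-- CONTAINMENT at the root: the hcp root hypothesis of record (`semOKH` on the full root box) gives the new one — nothing typed is lost, and
the new hypothesis is (weakly) WEAKER. [formal bookkeeping] -/
theorem semOKHQ_root_of_semOKH_root {μ : ℤ} (hH : semOKH μ rootCH rootWH = true) : semOKHQ μ rootCHQ rootWHQ = true :=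
  semOKHQ_of_semOKH_root hH rootCHQ rootWHQ

/-! ## §7. Kernel smoke tests of the prunes (tiny integer boxes; `SC = 2^48`) -/

/-- The box `ξ₁ ∈ [0.05, 0.15]` is outside `Σ`; the quarter root box is not; a box `ξ₀ ∈ [−0.05, 0.05]`, `ξ₁ ∈ [−0.25, −0.15]` inside `Σ` is not. -/
example :
    sectorOut (Function.update rootCHQ (Sum.inr 1) 28147497671066) (Function.update rootWHQ (Sum.inr 1) 14073748835533) = true ∧
      sectorOut rootCHQ rootWHQ = false ∧
      sectorOut (Function.update (Function.update rootCHQ (Sum.inr 1) (-56294995342131)) (Sum.inr 0) 0)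
        (Function.update (Function.update rootWHQ (Sum.inr 1) 14073748835533) (Sum.inr 0) 14073748835533) = false := by
  refine ⟨?_, ?_, ?_⟩ <;> decide +kernel

/-- The corner box `ξ ∈ [0.15, 0.25]³` is outside the ball `‖ξ‖ ≤ 1/4` (`3 · 0.15² = 0.0675 > 1/16`); the quarter root box is not. -/
example :
    ballOut (Function.update (Function.update (Function.update rootCHQ (Sum.inr 0) 56294995342131) (Sum.inr 1) 56294995342131) (Sum.inr 2) 56294995342131)
        (Function.update (Function.update (Function.update rootWHQ (Sum.inr 0) 14073748835533) (Sum.inr 1) 14073748835533) (Sum.inr 2) 14073748835533) = true ∧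
      ballOut rootCHQ rootWHQ = false := by
  refine ⟨?_, ?_⟩ <;> decide +kernel

/-- ★ The `C₃` lever AT T-RANGE `t`: the `120°`-image of the worst-ray SHEET CELL (hand-1 `wB08M` family: `|ξ⋆| = 3.88e-3` at `t = 0.65 t_b`,
shuffle half-widths `(1.73, 1.96, 1.25)e-3`) has `ξ`-centre `3.88e-3 · (cos 30°, sin 30°)` and is a VACUOUS `sectorOut` leaf (second disjunct:
`c₀ − w₀ = 1.63e-3 > 0`, `3 (w₁ − c₁)² = 1.2e-9 < (c₀ − w₀)² = 2.7e-6`), whereas the same image at `t = 0.30 t_b` (`|ξ⋆| = 1.04e-3 <` the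
half-widths) still STRADDLES `∂Σ` (not pruned) — the `t ≳ 0.42 t_b` threshold of the module docstring, checked by the kernel on the literal boxes. -/
example :
    sectorOut (Function.update (Function.update (Function.update rootCHQ (Sum.inr 0) 945806183801) (Sum.inr 1) 546061454819) (Sum.inr 2) 0)
        (Function.update (Function.update (Function.update rootWHQ (Sum.inr 0) 486951709709) (Sum.inr 1) 551690954353) (Sum.inr 2) 351843720888) = true ∧
      sectorOut (Function.update (Function.update (Function.update rootCHQ (Sum.inr 0) 253515059576) (Sum.inr 1) 146366987890) (Sum.inr 2) 0)
        (Function.update (Function.update (Function.update rootWHQ (Sum.inr 0) 486951709709) (Sum.inr 1) 551690954353) (Sum.inr 2) 351843720888) = false := by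
  refine ⟨?_, ?_⟩ <;> decide +kernel

end Summit.AtomisticToContinuum.Crystallization.Theorems.FrustratedLawDichotomyStrainedPatchHomEntrySemanticQuot

end
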